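import Summits.QuantumFields.YangMills.Theorems.AllWindowsColdBoxBoxHighLineLandauSourceInputs
import Summits.QuantumFields.YangMills.Theorems.AllWindowsColdBoxBoxHighLineLandauKernelBounds
import Summits.QuantumFields.YangMills.Theorems.AllWindowsColdBoxSchurJaffardGradient
import Summits.QuantumFields.YangMills.Theorems.AllWindowsColdBoxBoxWindowHighSU2213LineDefs

/-!
# LINE-20 «landau-rung3» stub U1 `stub_landauKernelPackage`, BY NAME: gradient (U1b) and dipole (U1c) decay of the Landau/Hodge kernel
# of the cold box (⟨stmt-QuantumFields-24336⟩ `AllWindowsColdBox.BoxWindowHighSU2213`; parent ⟨24004⟩)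

With w2's skin/rest block form of `hodgeQ` (✓`…SchurBlocks`), its inputs (h2) ✓`restInv_coupling_bound`, (J′2) ✓`schurSkin_coercive`,
(h3) ✓`schurSkin_decay_bound` and S3 ✓`stub_landauKernelBounds` (✓`…LandauKernelBounds`), the per-source inputs `a₀ … a₃` of
✓`…LandauSourceInputs` and the abstract gradient/dipole Schur–Jaffard theorems (✓`…SchurJaffardGradient`):
* **`RestBlock.landauKernelGradDecay : LandauKernelGradDecay`** (U1b) — `|(hodgeQ⁻¹ λ_p)(e)| ≤ C(1+log H)/(1+‖e−p‖₁)³`;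
* **`RestBlock.landauDipoleDecay : LandauDipoleDecay`** (U1c) — `|λ_pᵀ hodgeQ⁻¹ λ_q| ≤ C(1+log H)/(1+‖p−q‖₁)⁴`;
* **`stub_landauKernelPackage : LandauKernelPackage`** — the registered stub U1 of `Cruxes/BoxWindowHighSU2213/Lines/landau_rung3.lean`, BY NAME
  (`(LandauVarianceBounded ∧ LandauKernelDecay) ∧ LandauKernelGradDecay ∧ LandauDipoleDecay`).
The typed `(1 + log H)` factors are slack (the bounds hold without them).  Standard axioms.

HONEST LABEL: closes the registered stub U1 of ONE critic-stamped DRAFT line (rung 3 of the Landau chart) on the R2ξ″ all-windows crux; the line's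
load-bearing stub U5 `stub_landauThirdOrder` (XL, gated) and the declared residual U6 remain OPEN; ⟨24336⟩, ⟨24004⟩ stay OPEN; no crux, rung or
summit is proved; the Yang–Mills mass gap is NOT proved by this file.
-/

set_option autoImplicit false

noncomputable section

namespace Summit.QuantumFields.YangMills.Theorems.AllWindowsColdBoxBoxHighLine

open Finset Matrix
open Literature.Probability.LatticeModels (Site)
open Literature.MathematicalPhysics.QuantumFieldTheory
open Literature.MathematicalPhysics.QuantumFieldTheory.LatticeMaxwell
open Literature.MathematicalPhysics.QuantumFieldTheory.AxialGauge
open Summit.QuantumFields.YangMills.Theorems.WeakCouplingRates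
open Summit.QuantumFields.YangMills.Theorems.AllWindowsColdBox.BoxKernel

namespace RestBlock

variable {H : ℕ}

/-! ## The pseudo-metric and growth data of the skin/rest index set (as in `landauKernelBounds_of_inputs`) -/

/-- `sumDist` is nonnegative. -/
theorem sumDist_nonneg' (a b : Skin H ⊕ Rest H) : 0 ≤ sumDist H a b := linkDist_nonneg _ _

/-- `sumDist a a = 0`. -/
theorem sumDist_self' (a : Skin H ⊕ Rest H) : sumDist H a a = 0 := linkDist_self _

/-- `sumDist` is symmetric. -/
theorem sumDist_comm' (a b : Skin H ⊕ Rest H) : sumDist H a b = sumDist H b a := linkDist_comm _ _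

/-- `sumDist` satisfies the triangle inequality. -/
theorem sumDist_triangle' (a b c : Skin H ⊕ Rest H) : sumDist H a b ≤ sumDist H a c + sumDist H c b := linkDist_triangle _ _ _

/-- Cubic growth of the skin in `sumDist`. -/
theorem sumDist_skin_growth (y : Skin H ⊕ Rest H) (ρ : ℝ) (hρ : 0 ≤ ρ) :
    ((Finset.univ.filter (fun s : Skin H => sumDist H (Sum.inl s) y ≤ ρ)).card : ℝ) ≤ 256 * (1 + ρ) ^ (3 : ℝ) :=
  card_skin_ball_le (skinRest H y) ρ hρ

/-! ## The `ℓ¹` comparisons -/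

/-- `Σ_m |e_m − e'_m| ≤ 4·d_∞(e, e')`. -/
theorem cast_l1_le_four_mul_linkDist (e e' : LandauFree H) :
    (((∑ m : Fin 4, |e.1.1.1 m - e'.1.1.1 m|) : ℤ) : ℝ) ≤ 4 * linkDist e e' := by
  push_cast
  calc ∑ m : Fin 4, |((e.1.1.1 m : ℤ) : ℝ) - ((e'.1.1.1 m : ℤ) : ℝ)| ≤ ∑ _m : Fin 4, linkDist e e' :=
        Finset.sum_le_sum fun m _ => by have h := abs_sub_le_linkDist e e' m; rwa [Int.cast_sub] at h
    _ = 4 * linkDist e e' := by rw [Finset.sum_const, Finset.card_univ, Fintype.card_fin, nsmul_eq_mul]; norm_num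

/-! ## U1b: gradient decay -/

/-- **U1b (gradient decay of the Landau kernel)**: `|(hodgeQ⁻¹ λ_p)(e)| ≤ C(1 + log H)/(1 + ‖e − p‖₁)³`, uniformly in `H ≥ 1`. -/
theorem landauKernelGradDecay : LandauKernelGradDecay := by
  classical
  obtain ⟨c₂, hc₂, h2⟩ := restInv_coupling_bound
  obtain ⟨c₃, hc₃, h3⟩ := schurSkin_decay_bound
  obtain ⟨a₁, ha₁, hA1⟩ := PlaqSource.source_a1
  obtain ⟨a₂, ha₂, hA2⟩ := PlaqSource.source_a2
  obtain ⟨Cfin, hC0, hmain⟩ := Summit.QuantumFields.YangMills.Theorems.AllWindowsColdBox.Jaffard.schur_jaffard_gradient_decay.{0}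
    (DS := 3) (cS := 256) (c₂ := c₂) (c₃ := c₃) (m₀ := 1) (a₀ := 162) (a₁ := a₁) (a₂ := a₂)
    (by norm_num) (by norm_num) (by norm_num) hc₂ hc₃ one_pos (by norm_num) ha₁ ha₂
  refine ⟨64 * Cfin, fun H hH e p => ?_⟩
  haveI : NeZero H := ⟨by omega⟩
  have hlog : 0 ≤ Real.log H := Real.log_nonneg (by exact_mod_cast hH)
  have hℓ0 : 0 ≤ (((∑ m : Fin 4, |e.1.1.1 m - p.1 m|) : ℤ) : ℝ) := by
    exact_mod_cast Finset.sum_nonneg fun m _ => abs_nonneg (e.1.1.1 m - p.1 m)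
  have hden : 0 < (1 + (((∑ m : Fin 4, |e.1.1.1 m - p.1 m|) : ℤ) : ℝ)) ^ 3 := by positivity
  rw [le_div_iff₀ hden]
  by_cases hex : ∃ e₁ : LandauFree H, landauCoeff H p e₁ ≠ 0
  · obtain ⟨e₁, he₁⟩ := hex
    letI : DecidableEq (Skin H ⊕ Rest H) := instDecidableEqSum
    have hm := hmain (sumDist H) sumDist_nonneg' sumDist_self' sumDist_comm' sumDist_triangle' sumDist_skin_growth (skinBlock H)
      (coupling H) (restBlock H) (restInv H) skinBlock_isSymm restInv_isSymm restBlock_mul_restInv (fun r s => h2 H hH r s)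
      (schurSkin_coercive H hH) (fun s s' => h3 H hH s s') (fun s : Skin H => landauCoeff H p s.1) (fun r : Rest H => landauCoeff H p r.1)
      ((skinRest H).symm e₁) (fun s => PlaqSource.source_a0 he₁ s) (fun r => hA1 H hH he₁ r) (fun s => hA2 H hH he₁ s)
      ((skinRest H).symm e)
    rw [← PlaqSource.hodgeQ_inv_mulVec_eq (landauCoeff H p) e] at hm
    have hde : sumDist H ((skinRest H).symm e) ((skinRest H).symm e₁) = linkDist e e₁ := by simp [sumDist]
    rw [hde, show ((3 : ℝ)) = ((3 : ℕ) : ℝ) by norm_num, Real.rpow_natCast] at hm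
    -- compare `‖e − p‖₁` with `d_∞(e, e₁)`
    have hL0 : 0 ≤ linkDist e e₁ := linkDist_nonneg e e₁
    have htri : (∑ m : Fin 4, |e.1.1.1 m - p.1 m| : ℤ) ≤ (∑ m : Fin 4, |e.1.1.1 m - e₁.1.1.1 m|) + ∑ m : Fin 4, |e₁.1.1.1 m - p.1 m| :=
      l1_triangle _ _ _
    have h1 : (∑ m : Fin 4, |e₁.1.1.1 m - p.1 m| : ℤ) ≤ 1 := l1_le_one_of_landauCoeff_ne_zero he₁
    have h4 := cast_l1_le_four_mul_linkDist e e₁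
    have hcast : (((∑ m : Fin 4, |e.1.1.1 m - p.1 m|) : ℤ) : ℝ) ≤ 4 * linkDist e e₁ + 1 := by
      have : (((∑ m : Fin 4, |e.1.1.1 m - p.1 m|) : ℤ) : ℝ) ≤
          (((∑ m : Fin 4, |e.1.1.1 m - e₁.1.1.1 m|) : ℤ) : ℝ) + (((∑ m : Fin 4, |e₁.1.1.1 m - p.1 m|) : ℤ) : ℝ) := by exact_mod_cast htri
      have h1' : (((∑ m : Fin 4, |e₁.1.1.1 m - p.1 m|) : ℤ) : ℝ) ≤ 1 := by exact_mod_cast h1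
      linarith
    have hcmp : (1 + (((∑ m : Fin 4, |e.1.1.1 m - p.1 m|) : ℤ) : ℝ)) ^ 3 ≤ 64 * (1 + linkDist e e₁) ^ 3 := by
      calc (1 + (((∑ m : Fin 4, |e.1.1.1 m - p.1 m|) : ℤ) : ℝ)) ^ 3 ≤ (4 * (1 + linkDist e e₁)) ^ 3 :=
            pow_le_pow_left₀ (by linarith) (by linarith) 3
        _ = 64 * (1 + linkDist e e₁) ^ 3 := by ring
    have hX := abs_nonneg (((hodgeQ H)⁻¹ *ᵥ landauCoeff H p) e)
    calc |((hodgeQ H)⁻¹ *ᵥ landauCoeff H p) e| * (1 + (((∑ m : Fin 4, |e.1.1.1 m - p.1 m|) : ℤ) : ℝ)) ^ 3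
          ≤ |((hodgeQ H)⁻¹ *ᵥ landauCoeff H p) e| * (64 * (1 + linkDist e e₁) ^ 3) := mul_le_mul_of_nonneg_left hcmp hX
      _ = 64 * (|((hodgeQ H)⁻¹ *ᵥ landauCoeff H p) e| * (1 + linkDist e e₁) ^ 3) := by ring
      _ ≤ 64 * Cfin := mul_le_mul_of_nonneg_left hm (by norm_num)
      _ ≤ 64 * Cfin * (1 + Real.log H) := by nlinarith
  · rw [PlaqSource.landauCoeff_eq_zero_of_forall hex, Matrix.mulVec_zero, Pi.zero_apply, abs_zero, zero_mul]
    positivity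

/-! ## U1c: dipole decay -/

/-- **U1c (dipole decay of the Landau kernel)**: `|λ_pᵀ hodgeQ⁻¹ λ_q| ≤ C(1 + log H)/(1 + ‖p − q‖₁)⁴`, uniformly in `H ≥ 1`. -/
theorem landauDipoleDecay : LandauDipoleDecay := by
  classical
  obtain ⟨c₃, hc₃, h3⟩ := schurSkin_decay_bound
  obtain ⟨a₂, ha₂, hA2⟩ := PlaqSource.source_a2
  obtain ⟨a₃, ha₃, hA3⟩ := PlaqSource.source_a3
  obtain ⟨Cfin, hC0, hmain⟩ := Summit.QuantumFields.YangMills.Theorems.AllWindowsColdBox.Jaffard.schur_jaffard_dipole_decay'.{0}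
    (DS := 3) (cS := 256) (c₃ := c₃) (m₀ := 1) (a₀ := 162) (a₂ := a₂)
    (by norm_num) (by norm_num) (by norm_num) hc₃ one_pos (by norm_num) ha₂
  refine ⟨256 * (Cfin + a₃), fun H hH p q => ?_⟩
  haveI : NeZero H := ⟨by omega⟩
  have hlog : 0 ≤ Real.log H := Real.log_nonneg (by exact_mod_cast hH)
  have hℓ0 : 0 ≤ (((∑ m : Fin 4, |p.1 m - q.1 m|) : ℤ) : ℝ) := by
    exact_mod_cast Finset.sum_nonneg fun m _ => abs_nonneg (p.1 m - q.1 m)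
  have hden : 0 < (1 + (((∑ m : Fin 4, |p.1 m - q.1 m|) : ℤ) : ℝ)) ^ 4 := by positivity
  have hCa : 0 ≤ Cfin + a₃ := by positivity
  rw [le_div_iff₀ hden]
  by_cases hexp : ∃ e₁ : LandauFree H, landauCoeff H p e₁ ≠ 0
  · by_cases hexq : ∃ e₁' : LandauFree H, landauCoeff H q e₁' ≠ 0
    · obtain ⟨e₁, he₁⟩ := hexp
      obtain ⟨e₁', he₁'⟩ := hexq
      letI : DecidableEq (Skin H ⊕ Rest H) := instDecidableEqSum
      have hm := hmain (sumDist H) sumDist_nonneg' sumDist_self' sumDist_comm' sumDist_triangle' sumDist_skin_growth (skinBlock H)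
        (coupling H) (restBlock H) (restInv H) skinBlock_isSymm restInv_isSymm restBlock_mul_restInv
        (schurSkin_coercive H hH) (fun s s' => h3 H hH s s') (fun s : Skin H => landauCoeff H p s.1) (fun s : Skin H => landauCoeff H q s.1)
        (fun r : Rest H => landauCoeff H p r.1) (fun r : Rest H => landauCoeff H q r.1) ((skinRest H).symm e₁) ((skinRest H).symm e₁') a₃
        (fun s => PlaqSource.source_a0 he₁ s) (fun s => hA2 H hH he₁ s) (fun s => PlaqSource.source_a0 he₁' s) (fun s => hA2 H hH he₁' s)
        (hA3 H hH he₁ he₁')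
      rw [← PlaqSource.dotProduct_hodgeQ_inv_mulVec_eq (landauCoeff H p) (landauCoeff H q)] at hm
      have hde : sumDist H ((skinRest H).symm e₁) ((skinRest H).symm e₁') = linkDist e₁ e₁' := by simp [sumDist]
      rw [hde, show ((4 : ℝ)) = ((4 : ℕ) : ℝ) by norm_num, Real.rpow_natCast] at hm
      -- compare `‖p − q‖₁` with `d_∞(e₁, e₁')`
      have hL0 : 0 ≤ linkDist e₁ e₁' := linkDist_nonneg e₁ e₁'
      have htri1 : (∑ m : Fin 4, |p.1 m - q.1 m| : ℤ) ≤ (∑ m : Fin 4, |p.1 m - e₁.1.1.1 m|) + ∑ m : Fin 4, |e₁.1.1.1 m - q.1 m| :=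
        l1_triangle _ _ _
      have htri2 : (∑ m : Fin 4, |e₁.1.1.1 m - q.1 m| : ℤ) ≤ (∑ m : Fin 4, |e₁.1.1.1 m - e₁'.1.1.1 m|) + ∑ m : Fin 4, |e₁'.1.1.1 m - q.1 m| :=
        l1_triangle _ _ _
      have h1 : (∑ m : Fin 4, |p.1 m - e₁.1.1.1 m| : ℤ) ≤ 1 := by
        have h := l1_le_one_of_landauCoeff_ne_zero he₁
        calc (∑ m : Fin 4, |p.1 m - e₁.1.1.1 m| : ℤ) = ∑ m : Fin 4, |e₁.1.1.1 m - p.1 m| :=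
              Finset.sum_congr rfl fun m _ => abs_sub_comm _ _
          _ ≤ 1 := h
      have h1' : (∑ m : Fin 4, |e₁'.1.1.1 m - q.1 m| : ℤ) ≤ 1 := l1_le_one_of_landauCoeff_ne_zero he₁'
      have h4 := cast_l1_le_four_mul_linkDist e₁ e₁'
      have hcast : (((∑ m : Fin 4, |p.1 m - q.1 m|) : ℤ) : ℝ) ≤ 4 * linkDist e₁ e₁' + 2 := by
        have hint : (∑ m : Fin 4, |p.1 m - q.1 m| : ℤ) ≤ 1 + (∑ m : Fin 4, |e₁.1.1.1 m - e₁'.1.1.1 m|) + 1 := by linarith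
        have : (((∑ m : Fin 4, |p.1 m - q.1 m|) : ℤ) : ℝ) ≤ 1 + (((∑ m : Fin 4, |e₁.1.1.1 m - e₁'.1.1.1 m|) : ℤ) : ℝ) + 1 := by
          exact_mod_cast hint
        linarith
      have hcmp : (1 + (((∑ m : Fin 4, |p.1 m - q.1 m|) : ℤ) : ℝ)) ^ 4 ≤ 256 * (1 + linkDist e₁ e₁') ^ 4 := by
        calc (1 + (((∑ m : Fin 4, |p.1 m - q.1 m|) : ℤ) : ℝ)) ^ 4 ≤ (4 * (1 + linkDist e₁ e₁')) ^ 4 :=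
              pow_le_pow_left₀ (by linarith) (by linarith) 4
          _ = 256 * (1 + linkDist e₁ e₁') ^ 4 := by ring
      have hX := abs_nonneg (landauCoeff H p ⬝ᵥ ((hodgeQ H)⁻¹ *ᵥ landauCoeff H q))
      calc |landauCoeff H p ⬝ᵥ ((hodgeQ H)⁻¹ *ᵥ landauCoeff H q)| * (1 + (((∑ m : Fin 4, |p.1 m - q.1 m|) : ℤ) : ℝ)) ^ 4
            ≤ |landauCoeff H p ⬝ᵥ ((hodgeQ H)⁻¹ *ᵥ landauCoeff H q)| * (256 * (1 + linkDist e₁ e₁') ^ 4) :=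
            mul_le_mul_of_nonneg_left hcmp hX
        _ = 256 * (|landauCoeff H p ⬝ᵥ ((hodgeQ H)⁻¹ *ᵥ landauCoeff H q)| * (1 + linkDist e₁ e₁') ^ 4) := by ring
        _ ≤ 256 * (Cfin + a₃) := mul_le_mul_of_nonneg_left hm (by norm_num)
        _ ≤ 256 * (Cfin + a₃) * (1 + Real.log H) := by nlinarith
    · rw [PlaqSource.landauCoeff_eq_zero_of_forall hexq, Matrix.mulVec_zero, dotProduct_zero, abs_zero, zero_mul]
      positivity
  · rw [PlaqSource.landauCoeff_eq_zero_of_forall hexp, zero_dotProduct, abs_zero, zero_mul]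
    positivity

end RestBlock

/-! ## U1 by name -/

/-- **Stub U1 of LINE-20 (`stub_landauKernelPackage`), BY NAME: the kernel package of rung 3** — bounded Landau variances and Coulomb
decay (S3, ✓`stub_landauKernelBounds`), gradient decay against plaquette sources (U1b) and dipole decay (U1c) of the Landau/Hodge kernel of
the cold box. -/
theorem stub_landauKernelPackage : LandauKernelPackage :=
  ⟨stub_landauKernelBounds, RestBlock.landauKernelGradDecay, RestBlock.landauDipoleDecay⟩

end Summit.QuantumFields.YangMills.Theorems.AllWindowsColdBoxBoxHighLine

end
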